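import Summits.QuantumFields.YangMills.Theorems.BalabanUVNodesN15TwoGridDressedUnitLayerFaces
import Summits.QuantumFields.YangMills.Theorems.BalabanUVNodesN15TwoSpacingGluingNeumannKnitN15AtPinned
import HarnessLib

/-!
# N15 (NE2) — PROGRAMME Λ-U, part Λ-H: THE ALL-ENTRIES ∕ UNIT-LIVE FAMILY OF THE PAIR OF RECORD PINNED — `KeyedLive` and `Live ∧ N15At` at every Stage-13 bundle of record from a pin
# of the reading's NE2 objects to Λ-F's literal `allEntriesBgObjects` (the two `GuardedReading`-corner faces of the K3⁸ skeleton, pattern of g23's `…TwoSpacingGluingNeumannKnitN15AtPinned`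
# for a would-be re-pin from S-B's U-blind `fullGSizedObjects` to the background-live pair of record)

WHO ∕ WHEN.  Cell `pub-ymgap`, seat `pub-ymgap-dag-n15-a` (KNIT-BY-NAME seat of Track-A DAG node N15 = NE2, g27); `--kind proof --supports stmt-QuantumFields-27366 --as helper` (K3⁸;
count-neutral).  THEOREMS ONLY (0 `def`).  Over Λ-G `…TwoGridDressedUnitLayerFaces` (`n15At_allEntriesBgObjects_family`, `live_allEntriesBgObjects_family`), Λ-F (`allEntriesBgObjects`),
dag-n15-w2's `PairedFamilyGuard` (`Live`, `KeyedLive`), RR-1's Stage-13 `CoPH` reading types (`RateReading₁₃CoPH`, `rateCarriersOfRecord₁₃CoPH`), part 30 (`neZero_blockFactor`) BY NAME;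
nothing in the tree is modified.

WHAT.  `live_and_n15At_allEntriesBgObjects_family` (the family spelling `(d, L) := (3, F.L)`), ★★ `keyedLive_of_pinnedAllEntriesBg` (pinned ⟹ w2's `KeyedLive`, every run-length selector), ★★
`live_and_n15At_rrOfRecord_of_pinnedAllEntriesBg` (pinned ⟹ `Live ∧ N15At` at every bundle of record) — hypothesis = the body a `N15Pinned…` stub re-pinned to this family would have:
`∃ b a_S ν κ α β c₃₅ p, 0 < b ∧ 0 < a_S ∧ 0 < c₃₅ ∧ ∀ F ϑ hP g₀ os k, (𝔯.lit F ϑ hP g₀ os).ne2 k = allEntriesBgObjects 3 F.hL b a_S ν κ α β c₃₅ p`.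

HONEST FRAMING ∕ LIMITS.  By-name bookkeeping; no estimate.  The pinned objects are Λ-F's MODEL-LEVEL family (abelianised first-order species of (3.52)'s `V′(A)`, (C3) transport, abelianised `Q`,
linearised (1.66) dressing): OPERATOR (all four (3.42) entries, Λ-C) and UNIT (Λ-F) layers READ `U`, SITE U-blind (G1), Bałaban's size `M` live through `c₃₅·M·α₀`; NOT [B9] Thms 3.1∕3.2∕3.15 at
general `U`, NOT Node 00's objects of record, NOT the non-abelian dressing (n15-c); no pin is asked of the plan here (K3⁸ v7 keeps its own pin; the planner decides); NE2⁺ NOT PRINTED ∕ NOT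
proved; N15 NOT discharged; counts of record UNMOVED by this seat; one finite 𝕋⁴ at fixed ε per index — NOT infinite volume, NOT OS on ℝ⁴, NOT a mass gap, NOT Clay.
-/

noncomputable section

namespace Summit.QuantumFields.YangMills.BalabanUVNodes.N15.UnitLayerBg

open Literature.MathematicalPhysics.QuantumFieldTheory.Balaban1983to89
open Literature.MathematicalPhysics.QuantumFieldTheory.Balaban1983to89.T4Continuum (T4Family ULoop)
open Node00 (Stage13HParams NE2Objects₁₁)
open Summit.QuantumFields.YangMills.BalabanUVNodes.N15.AtKeyedHome (neZero_blockFactor)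
open Summit.QuantumFields.YangMills.BalabanUVNodes.N15.PairedFamilyGuard (Live KeyedLive)
open YMDAG.UVSplit (N15At ne2OfRecord₁₁ RateReading₁₃CoPH rateCarriersOfRecord₁₃CoPH)

/-- **GUARD ∧ `N15At` FOR THE ALL-ENTRIES ∕ UNIT-LIVE LITERAL IN THE FAMILY SPELLING** (`(d, L) := (3, F.L)`; `b, a_S, c₃₅ > 0`). [bookkeeping] -/
theorem live_and_n15At_allEntriesBgObjects_family (F : T4Family) {b aS c35 : ℝ} (hb : 0 < b) (haS : 0 < aS) (hc35 : 0 < c35) (ν κ α β : Fin 4) (p : ℝ) :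
    haveI := neZero_blockFactor F
    Live (ne2OfRecord₁₁ (allEntriesBgObjects 3 F.hL b aS ν κ α β c35 p)) ∧ N15At (ne2OfRecord₁₁ (allEntriesBgObjects 3 F.hL b aS ν κ α β c35 p)) :=
  ⟨live_allEntriesBgObjects_family b aS ν κ α β hc35.le p F, n15At_allEntriesBgObjects_family hb haS hc35 ν κ α β p F⟩

variable {N : ℕ} [NeZero N]

/-- ★★ **PINNED TO THE ALL-ENTRIES ∕ UNIT-LIVE FAMILY ⟹ KEYED-LIVE, EVERY SELECTOR**: if the reading's N15 objects are `allEntriesBgObjects 3 F.hL …` at every tuple and run length (for some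
`b, a_S, c₃₅ > 0`, directions, `p`), then w2's `KeyedLive` holds at the bundle of record for every run-length selector. [bookkeeping] -/
theorem keyedLive_of_pinnedAllEntriesBg (𝔯 : RateReading₁₃CoPH N)
    (hpin : ∃ (b aS : ℝ) (ν κ α β : Fin 4) (c35 p : ℝ), 0 < b ∧ 0 < aS ∧ 0 < c35 ∧
      ∀ (F : T4Family) (ϑ : Stage13HParams F N) (hP : ϑ.Provisos₁₃CoPH F N) (g₀ : ℕ → ℝ) (os : List (ULoop F)) (k : ℕ),
        (𝔯.lit F ϑ hP g₀ os).ne2 k = haveI := neZero_blockFactor F; allEntriesBgObjects 3 F.hL b aS ν κ α β c35 p)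
    (ksel : (F : T4Family) → (ϑ : Stage13HParams F N) → ϑ.Provisos₁₃CoPH F N → (ℕ → ℝ) → List (ULoop F) → ℕ) :
    KeyedLive (fun F ϑ hP g₀ os => rateCarriersOfRecord₁₃CoPH 𝔯 F ϑ hP g₀ os (ksel F ϑ hP g₀ os)) := by
  obtain ⟨b, aS, ν, κ, α, β, c35, p, -, -, hc35, h⟩ := hpin
  intro F ϑ hP _ _ g₀ os
  show Live (ne2OfRecord₁₁ ((𝔯.lit F ϑ hP g₀ os).ne2 (ksel F ϑ hP g₀ os)))
  rw [h F ϑ hP g₀ os (ksel F ϑ hP g₀ os)]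
  exact live_allEntriesBgObjects_family b aS ν κ α β hc35.le p F

/-- ★★ **PINNED TO THE ALL-ENTRIES ∕ UNIT-LIVE FAMILY ⟹ `Live ∧ N15At` AT EVERY BUNDLE OF RECORD** (every Stage-13 parameter with provisos, every `(g₀, os)`, every selector). [bookkeeping] -/
theorem live_and_n15At_rrOfRecord_of_pinnedAllEntriesBg (𝔯 : RateReading₁₃CoPH N)
    (hpin : ∃ (b aS : ℝ) (ν κ α β : Fin 4) (c35 p : ℝ), 0 < b ∧ 0 < aS ∧ 0 < c35 ∧
      ∀ (F : T4Family) (ϑ : Stage13HParams F N) (hP : ϑ.Provisos₁₃CoPH F N) (g₀ : ℕ → ℝ) (os : List (ULoop F)) (k : ℕ),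
        (𝔯.lit F ϑ hP g₀ os).ne2 k = haveI := neZero_blockFactor F; allEntriesBgObjects 3 F.hL b aS ν κ α β c35 p)
    (ksel : (F : T4Family) → (ϑ : Stage13HParams F N) → ϑ.Provisos₁₃CoPH F N → (ℕ → ℝ) → List (ULoop F) → ℕ)
    (F : T4Family) (ϑ : Stage13HParams F N) (hP : ϑ.Provisos₁₃CoPH F N) (g₀ : ℕ → ℝ) (os : List (ULoop F)) :
    Live (rateCarriersOfRecord₁₃CoPH 𝔯 F ϑ hP g₀ os (ksel F ϑ hP g₀ os)).ne2 ∧ N15At (rateCarriersOfRecord₁₃CoPH 𝔯 F ϑ hP g₀ os (ksel F ϑ hP g₀ os)).ne2 := by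
  obtain ⟨b, aS, ν, κ, α, β, c35, p, hb, haS, hc35, h⟩ := hpin
  show Live (ne2OfRecord₁₁ ((𝔯.lit F ϑ hP g₀ os).ne2 (ksel F ϑ hP g₀ os))) ∧ N15At (ne2OfRecord₁₁ ((𝔯.lit F ϑ hP g₀ os).ne2 (ksel F ϑ hP g₀ os)))
  rw [h F ϑ hP g₀ os (ksel F ϑ hP g₀ os)]
  exact live_and_n15At_allEntriesBgObjects_family F hb haS hc35 ν κ α β p

end Summit.QuantumFields.YangMills.BalabanUVNodes.N15.UnitLayerBg

end
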